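import Summits.Schanuel.Schanuel.Theorems.RootDecomp1KSectorTheorem10

/-!
# RootDecomp1KResidueDescent — lens 1, generation 68, NODE 28 «DESCENT INTO THE SECTOR — BOTH RESIDUE EXHIBITS OF RECORD DECIDED» (×0-AS-RECORD, PRICE L3059; ERRATUM E5; CLAIM L3057, NODE L3068, VERDICT L3071): `thinFibreAt_rho1` / `levelFinite_rho1` (no level point at ANY N ≥ 4 — bi-pure gcd descent + the digit mod 32; family `quartC c = Y⁴ + x·Y − c·x²`, c an odd prime ≢ 1 mod 32) and `thinFibreAt_rho2` / `levelFinite_rho2` (descent onto the x-LINEAR auxiliaries `17Y⁴ + Y³ − x`, `Y⁴ + Y³ − 17³·x`, decided by the TREE's `levelFinite_xLinear` ← node 2's `thinFibreAt_xLinear`; family `bisqC c = (Y² − c·x)² − x·Y`), and the typed NOT-BI-PURE nominees `residue_rho1'` / `residue_rho2'` (ρ1′ = Y⁴ + Y³ + x·Y + x − 17x², ρ2′ = (Y² − 17x)² − x·Y − x) — part 1 (RootDecomp1KResidueDescent01): §0  THE TWO EXHIBITS OF RECORD — the TREE's `rho1`, `rho2` (node 27, port part 09, BY NAME) — as members of tw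 · §1  ARITHMETIC OF THE DIGIT: `a` odd ⟹ `a⁸ ≡ 1 (mod 32)`; cubes and units mod 32 · §2  THE CORE OF ρ1: `W⁴ + p·2^m·W − c·p² = 0`, `p ≡ 1 (mod 2^m)`, `m ≥ 5`, `c` an odd prime `≢ 1 (mod 32)` ⟹ ⊥ · §3  CLEARING THE LEVEL EQUATION of `Y⁴ + α·x·Y² + β·x·Y + γ·x²` at a dyadic abscissa `x = p/2^{2m}` — 20 declarations `quartC` … `int_eq4`

(lens-1 g68 NODE 28 «DESCENT INTO THE SECTOR» L3068: HOME kernel K = HOME/decomp-schanuel-lens-1/g68/lean/ResidueDescent.lean sha256 7ab17922…, 1232 l, 74 decls (70 theorems + 4 defs), ONE namespace `Summit.Schanuel.Schanuel.Theorems.RootDecomp1KResidueDescent`, imports the tree port …RootDecomp1KSectorTheorem10 ONLY (node 27's THEOREM ×1 port; `rho1` / `rho2` / `Residue` / `SectorCond` / `exists_fourth_root_seventeen` / `exists_sqrt_seventeen` / `levelFinite_xLinear` / `levelFinite_of_thinFibreAt_zero` BY TREE NAME); no private / instance / set_option / notation / sorry / new axiom / binder, `decide` only on ZMod 32 / small literals;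 lens farm rc 0 · 0 errors · 0 sorries · 74 dupNamespace, `--axioms` standard on 17 names, Probe g68/out/Probe.lean 9038b768… rc 0, memo g68/NODE-g68.md 3833b29f…; CLAIM L3057 (ASK-FIRST under K-R58 (iii)); crit g12 PRICE L3059: ×0-AS-RECORD («the levers are bi-pure DESCENT ∪ LOCAL SIEVING mod 32 (ρ1) ∪ the EDGE ENGINE BY NAME (ρ2)»), correction e28-pre-1 (the w = 289 auxiliary `Y⁴ + Y³ − 17³·x`, ADOPTED by the lens), CHECKLIST K-g68 (D1)–(D5) + (S), ERRATUM E5 PRE-ANNOUNCED (exhibits of record must be typed-Residue AND not toolkit-decided, in particular NOT bi-pure; rho1 / rho2 leave the exhibit list and join the unconditional part; exhibits := ∅ until ρ1′ / ρ2′ are certified); writer g35 pre-check NOTE 1 L3060; census LIVENESS-v38 (key bipure: rho1 / rho2 bi-pure, ρ1′ / ρ2′ not; key edge on the nominees: ρ1 / ρ2 by the recipe); crit g12 VERDICT L3071 (04:51Z): ×0-AS-RECORD BOOKED (CHECKLIST K-g68 (D1)–(D4) + (S) met on the critic's own farm runs; (D5) declined-as-typed, families instead), TALLY UNCHANGED lens-1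 ×22 + THEOREM ×24, ERRATUM E5 FIXED (PRICE L3059 (E5-a)–(E5-d) verbatim; instantiation: toolkit ∪= bi-pure descent; rho1 / rho2 leave the exhibit list and join the unconditional part; exhibits of record := ρ1′ / ρ2′ effective at port landing; ledger and non-dominant territory unchanged), W-28-1 (typed (T♭) welcome, ×0), PORT GO → census-1 (this port; PORT IDENTITY 28 owed by the seated critic). Port by census-1 gen 25 as `RootDecomp1KResidueDescent01–04` (files ≤ 400 lines; `--supports stmt-Schanuel-33364`, the item stays OPEN; ×0 record port, no credit anywhere; E5: UNCONDITIONAL PART ∪= these names): 01 = K l.1–378 of the prepped source (opens §0 / §1 / §2 / §3) — 20 decls `quartC`, `bisqC`, `rho1_eq_quartC`, …, `int_eq4`; 02 = K l.379–693 of the prepped source (opens §4 / §5 / §6) — 17 decls `shape4`, `level_exponent`, `two_pow_dvd_psNumer_sub_one`, …, `bound_one`; 03 = K l.694–941 of the prepped source (opens # The x-linear input BY TREE NAME: `RootDecomp1KXLinear.thinFibreAt_xLinear` (XLinear05) at quality `0` / # (D2) THE STRATUM-ρ2 EXHIBIT OF RECORD `rho2 = (Y² − 17x)² − x·Y`, DECIDED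 / # Sanity instance (PRICE L3059): the level-`m = 8` integer point of the ρ2 equation and its descent parameter / §7 / # ρ1′ = `Y⁴ + Y³ + x·Y + x − 17·x²`) — 26 decls `bound_two`, `three_le_abs`, `aeval_aux₁`, …, `rho1'_axisY_two_monomials`; 04 = K l.942–1253 of the prepped source (opens # ρ2′ = `(Y² − 17x)² − x·Y − x`) — 11 decls `residue_rho1'`, `sectorCond_rho1'`, `rho2'`, …, `nominees`. 22 one-line docstrings synthesised for undocumented helper declarations (statements quoted); everything else = K VERBATIM (statements, names, proofs, K's module docstring kept in part 01 below this provenance block).)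
-/

/-!
# RootDecomp1KResidueDescent — lens 1, generation 68, NODE 28 «DESCENT INTO THE SECTOR — BOTH RESIDUE EXHIBITS OF
RECORD DECIDED» (CLAIM L3057 · PRICE L3059: ×0-AS-RECORD, PORTS WELCOME, CHECKLIST K-g68 (D1)–(D5) + (S), correction
e28-pre-1, ERRATUM E5 pre-announced · writer NOTE 1 L3060 (second instrument, 43/43 PASS, D1 = e28-pre-1))

HOME kernel `K = HOME/decomp-schanuel-lens-1/g68/lean/ResidueDescent.lean`, ONE namespace
`Summit.Schanuel.Schanuel.Theorems.RootDecomp1KResidueDescent`, imports the tree port `…RootDecomp1KSectorTheorem10` ONLY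
(node 27's record port, parts 01–10 = THE WHOLE PORT, LANDED (PORT LANDED L3061, PORT IDENTITY 27 L3062, PORT NOTE 27
L3064) AND BUILT on the seat farm; its closure holds every cell file used).  The exhibits of record `rho1`, `rho2`, their
coefficient lemmas `rho1_zero … rho2_two`, the predicates `Residue` / `SectorCond`, the Hensel lemmas
`exists_padicInt_root`, `exists_fourth_root_seventeen`, `exists_sqrt_seventeen` (part 09) and the quality-0 facts
`levelFinite_of_thinFibreAt_zero`, `levelFinite_xLinear` (part 10) are the TREE's, used BY NAME — NO re-typed
declaration, no PORT IDENTITY owed: every declaration of this kernel is new.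
Tree facts BY NAME: `ThinFibreAt` (DegreeLadder06 l.77), `bev`, `xPolyP`, `bev_xPolyP` (XTop01), `xLinP`, `bev_xLinP`,
`thinFibreAt_xLinear` (XLinear02/05), `LevelSet`, `LevelFinite`, `thinFibreAt_of_levelFinite` (LevelFinite01),
`levelFinite_of_no_level` (OddEmpty01), `BddLevelEmpty`, `bddLevelEmpty_iff_levelFinite` (HeightGrading01), `psNumer`,
`partialSum_eq_psNumer_div` (TwoBaseCell), `psNumer_succ`, `psNumer_lt` (DegreeLadder06), `odd_psNumer_two`,
`two_pow_dvd_of_dvd_mul_odd` (DigitPincer02), `partialSum_two_eq_int_div` (TrinomialDescent03), `psNumer_pos_runge`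
(Runge01), `Residue`, `SectorCond`, `EdgeGood`, `TopWeight`, `RootGood`, `layerPoly`, `supp`, `layerPoly_eq_sum`,
`mem_supp_of`, `aeval_eq_eval_map` (SectorTheorem01/03/06), `rho1`, `rho2`, `rho1_zero … rho2_two`, `residue_rho1`
(quoted only), `aeval_intCast_padicInt`, `exists_padicInt_root`, `exists_fourth_root_seventeen`, `exists_sqrt_seventeen`
(SectorTheorem09), `levelFinite_of_thinFibreAt_zero`, `levelFinite_xLinear`, `residue_rho2` (quoted only)
(SectorTheorem10), `rootMult` (LocalExponent03).  Mathlib: `Int.exists_gcd_one'`,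
`Int.sq_of_isCoprime`, `Int.pow_dvd_pow_iff`, `IsCoprime.isUnit_of_dvd'`, `Nat.dvd_prime_pow`, `decide` on `ZMod 32`
(never on levels), `hensels_lemma` (§7 exhibits only).  No `private`, no `instance`, no `set_option`, no notation, no
sorry, no new axiom, no binder; seat farm rc 0 · 0 errors · 0 sorries · warnings `linter.dupNamespace` only (tree-wide);
axioms {propext, Classical.choice, Quot.sound} on every (D1)/(D2)/(D4) name (g68/out/ax_*.json).

## THESIS (node 28).  The two residue EXHIBITS OF RECORD of node 27 / K-R58 (ii) — `rho1 = Y⁴ + x·Y − 17·x²`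
(stratum ρ1, SUBSPACE) and `rho2 = (Y² − 17x)² − x·Y` (stratum ρ2, MULTIPLE), both TRUE members of the typed first-order
residue `Residue m₀ 2 ·` for `m₀ ≤ 2` (tree `residue_rho1`, K g67 `residue_rho2`) — are nevertheless DECIDED,
HYPOTHESIS-FREE, for EVERY quality `m₀`: `thinFibreAt_rho1 (m₀)`, `thinFibreAt_rho2 (m₀)`, indeed `LevelFinite` both.
The lever is NOT the edge engine: it is an INTEGRALITY ACCIDENT of the two presentations — both are BI-PURE (`P(0, Y)`
and `P(x, 0)` are single monomials: `Y⁴` / `−17x²`, resp. `Y⁴` / `289x²`), so at a level `x = s_N = p/2^{N!}`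
(`p = psNumer 2 N` odd) the MONIC cleared level equation has an INTEGER root `W = 2^{N!/2}·r` with `rad p ∣ W`, and the
gcd split `W = g·w`, `p = g·q`, `gcd(w, q) = 1` runs a classical DESCENT:
(ρ1) `W⁴ + p·2^m·W − 17·p² = 0` (`N! = 2m`) ⟹ `w ∣ 17`; `w = ±1` ⟹ `q = a²`, `17q − w·2^m = b²`, and the DIGIT
`p ≡ 1 (mod 2^{N! − (N−1)!}) ⊇ (mod 32)` (`N ≥ 4`; tree `psNumer_succ`) gives `p² = a⁶b² ≡ 1`, `17a⁸ ≡ b²·a⁶… ≡ 17 ≢ 1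
(mod 32)`: ⊥; `w = ±17` ⟹ `17³ ≡ 1 (mod 32)`: ⊥ (`core_quart`, for EVERY odd prime `c ≢ 1 (mod 32)` in place of 17)
— so `rho1` has NO LEVEL POINT AT ANY LEVEL `N ≥ 4`, ANY HEIGHT (`no_level_rho1`), `LevelSet ⊆ {0,1,2,3}`, `LevelFinite`,
`ThinFibreAt m₀ ∀ m₀`.
(ρ2) `(W² − 17p)² = p·2^{2h}·W` (`N! = 4h` for `N ≥ 4`) ⟹ `W > 0`, `w ∣ 17²`; `w = 1` ⟹ `2^h ∣ g − 17q`, `q = a²`,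
`p = a³(17a + 2^h)`, and `t := a/2^h` (EITHER SIGN) satisfies `17t⁴ + t³ = s_N`, `|t| ≤ 1`; `w = 17`: ⊥ (a unit
argument); `w = 289` ⟹ `17³·p = a³(a + 2^h)`, `t := a/2^h` satisfies `t⁴ + t³ = 17³·s_N`, `|t| ≤ 34` (`core_bisq`,
`bound_one`, `bound_two`, `level_transport_bisqC`, for EVERY odd prime `c`) — so every level `N ≥ 4` of `rho2` (ANY
height) is a level of the x-LINEAR auxiliary `17·Y⁴ + Y³ − x` at height `1` or of `Y⁴ + Y³ − 4913·x` at height `34`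
(`levelSet_rho2_subset`; e28-pre-1: `−4913 = −17³`, not `−17`; height `34 ≥ 11`, both signs of `t` admitted so no `±`
variants), and both auxiliaries are LEVEL-FINITE by the tree's `thinFibreAt_xLinear` at quality 0 (`deg B + 2 = 2 ≤ 4 =
deg A`; the TREE's `levelFinite_xLinear`, part 10): `levelFinite_rho2`, `thinFibreAt_rho2 (m₀) ∀ m₀` — HYPOTHESIS-FREE.

## CHECKLIST K-g68 (PRICE L3059) item by item
(D1) `no_level_rho1 : 4 ≤ N → ∀ r, bev (xPolyP 2 rho1) (partialSum 2 N) r ≠ 0`, `levelSet_rho1_subset`,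
`levelFinite_rho1`, `bddLevelEmpty_rho1`, `thinFibreAt_rho1 (m₀)`, `thinFibreAt_two_rho1` — HYPOTHESIS-FREE; `rho1` = the TREE's
`RootDecomp1KSectorTheorem.rho1` BY NAME (part 09; the Probe also pins its body by `rfl`).  (D2) `levelSet_rho2_subset`, `levelFinite_rho2`, `bddLevelEmpty_rho2`, `thinFibreAt_rho2 (m₀)`,
`thinFibreAt_two_rho2` — HYPOTHESIS-FREE (the x-linear input is the TREE's `levelFinite_xLinear` ←
`RootDecomp1KXLinear.thinFibreAt_xLinear` ← the PROVED `Ridout.padicRoth_int`); the explicit-hypothesis form `levelFinite_rho2_of (h₁ h₂)` is kept for the record; auxiliaries of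
record `xLinP (C 17 * X ^ 4 + X ^ 3) (C (-1))` @ height `1` and `xLinP (X ^ 4 + X ^ 3) (C (-17 ^ 3))` @ height `34`.
(D3) typed inside K: integrality / parity `int_eq4`, `shape4` (`den r = 2^m`, `num r` odd, the monic integer equation),
the digit `two_pow_dvd_psNumer_sub_one` (`2^{N!−(N−1)!} ∣ p_N − 1`, from tree `psNumer_succ`) with `level_exponent`, the
gcd splits and descents `core_quart` (`w ∣ c`, `q = a²`, the `a⁸ ≡ 1 (mod 32)` obstruction `pow_eight_mod`, `cube_mod`)
and `core_bisq` (`w ∣ c²`, three branches, one-parameter output), the archimedean bookkeeping `bound_one`, `bound_two`,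
the LEVEL ↦ AUXILIARY-LEVEL MAP `level_transport_bisqC` / `levelSet_bisqC_subset` / `levelSet_rho2_subset` (so that
`LevelFinite` transfers by `Set.Finite.subset`: `levelFinite_bisqC_of`).  (D4) DELIVERED (§7): the replacement nominees
`rho1' = Y⁴ + Y³ + x·Y + x − 17x²` and `rho2' = (Y² − 17x)² − x·Y − x` typed against the TREE predicate:
`residue_rho1' (hm : m₀ ≤ 2) : Residue m₀ 2 rho1'`, `sectorCond_rho1' (3 ≤ m₀)`, `residue_rho2' (hm : m₀ ≤ 2)`,
`sectorCond_rho2' (3 ≤ m₀)` (layer tables in the docstrings), plus the decidable NON-BI-PURITY facts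
`rho1'_axisY_two_monomials` (`ρ1′(0,Y) = Y⁴ + Y³`), `rho2'_axisX_two_monomials` (`ρ2′(x,0) = 289x² − x`) and the summary
`nominees`; NOT claimed: that ρ1′/ρ2′ are undecided by other toolkit members (K-R58 (ii) (d0′) «as far as the record
knows»).  (D5) NOT delivered as a general typed (T♭) statement: the natural generality of the two descents is typed
instead — `no_level_quartC` / `thinFibreAt_quartC` for the whole family `Y⁴ + x·Y − c·x²`, `c` ANY odd prime `≢ 1
(mod 32)`, and `levelFinite_bisqC` / `thinFibreAt_bisqC` for `(Y² − c·x)² − x·Y`, `c` ANY odd prime; a uniform bi-pure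
transport lemma is left as toolkit TEXT (memo NODE-g68.md §5).  (S) as stated above; Probe `g68/out/Probe.lean` = K
verbatim + section `Probes28` (read-backs by `rfl`, every (D1)/(D2)/(D4) name by name, the `m = 8` instance
`(W, p) = (721, 35329 = 7³·103)`, `a = −7`, `t = −7/16` by `norm_num`, the identity `partialSum 2 N = psNumer 2 N / 2^{N!}`
by the tree's `partialSum_two_eq_int_div`, `psNumer_succ` cited by tree name).

## HONESTY.  RUNG 0.  `stmt-Schanuel-33364` (FiniteOrderLiouvilleSchanuel) / 33363 / 31077 / 31987 UNMOVED; the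
payable items of K-R58 (iii) — W4 (`W4P`, conditional on `PadicSubspace`), the UNIFORM `ThinFibreAt 2`, any binder
(`PadicSubspace`, `NWMeasure`, …) — UNTOUCHED.  «rho1 DECIDED ≠ PadicSubspace DECIDED»: what falls is the PRESENTATION
`rho1`, by the integrality accident of bi-purity; the Subspace-type statement about its branch (second Puiseux
coefficient `−β²/68` irrational) is neither used nor advanced, and `residue_rho1/2` (statements about edge data) stay
TRUE.  `W4P = x²(Y⁴ − 17) + x(Y³ + 1) + (Y + 2)` is NOT bi-pure (`P(0,Y) = Y + 2`) — checked, not claimed; the nominees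
ρ1′/ρ2′ are not bi-pure by `rho1'_axisY_two_monomials` / `rho2'_axisX_two_monomials`.  Levels `N ≤ 3` of `rho1` are
not decided individually (`LevelSet ⊆ {N < 4}` is what `LevelFinite`/`ThinFibreAt` need).  PRICING of record: ×0-AS-RECORD
(PRICE L3059, accepted in the CLAIM), ERRATUM E5 (K-R58 (ii): exhibits of record := toolkit-undecided, in particular not
bi-pure; rho1/rho2 join the UNCONDITIONAL PART), tally lens-1 ×22 + THEOREM ×24 unchanged.  Numerics (local, seconds;
g68/pre/): `rho1_check.py` (all integer solutions of `W⁴ + p·2^m·W − 17p² = 0`, `m ≤ 16`, `|W| ≤ 2·10⁵`: none with `p` odd,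
`p ≡ 1 (mod 32)`, `m ≥ 5`), `rho2_check.py` (all solutions of `(W² − 17p)² = p·2^m·W` in the same box: every odd-`p`
solution has `m` even and is of the `w = 1` shape `p = a³(17a ± 2^{m/2})`; the `w = 289` solutions start beyond the box,
PRICE L3059).
-/

noncomputable section

namespace Summit.Schanuel.Schanuel.Theorems.RootDecomp1KResidueDescent

open Polynomial LiouvilleNumber
open scoped Nat
open Summit.Schanuel.Schanuel.Theorems.RootDecomp1KTwoBaseCell (psNumer partialSum_eq_psNumer_div coprime_psNumer)
open Summit.Schanuel.Schanuel.Theorems.RootDecomp1KDegreeLadder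
open Summit.Schanuel.Schanuel.Theorems.RootDecomp1KXLinear (xLinP bev_xLinP thinFibreAt_xLinear)
open Summit.Schanuel.Schanuel.Theorems.RootDecomp1KXTop
open Summit.Schanuel.Schanuel.Theorems.RootDecomp1KLevelFinite
open Summit.Schanuel.Schanuel.Theorems.RootDecomp1KOddEmpty (levelFinite_of_no_level)
open Summit.Schanuel.Schanuel.Theorems.RootDecomp1KHeightGrading (BddLevelEmpty bddLevelEmpty_iff_levelFinite)
open Summit.Schanuel.Schanuel.Theorems.RootDecomp1KDigitPincer (odd_psNumer_two two_pow_dvd_of_dvd_mul_odd)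
open Summit.Schanuel.Schanuel.Theorems.RootDecomp1KTrinomialDescent (partialSum_two_eq_int_div)
open Summit.Schanuel.Schanuel.Theorems.RootDecomp1KRunge (psNumer_pos_runge)
open Summit.Schanuel.Schanuel.Theorems.RootDecomp1KLocalExponent (rootMult)
open Summit.Schanuel.Schanuel.Theorems.RootDecomp1KSectorTheorem (Residue SectorCond EdgeGood TopWeight RootGood layerPoly supp
  layerPoly_eq_sum mem_supp_of aeval_eq_eval_map rho1 rho2 rho1_zero rho1_one rho1_two rho2_zero rho2_one rho2_two
  aeval_intCast_padicInt exists_padicInt_root exists_fourth_root_seventeen exists_sqrt_seventeen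
  levelFinite_of_thinFibreAt_zero levelFinite_xLinear)

/-! ## §0  THE TWO EXHIBITS OF RECORD — the TREE's `rho1`, `rho2` (node 27, port part 09, BY NAME) — as members of two
one-parameter families `quartC c`, `bisqC c` -/

/-- the x-coefficient vector of `R₁(c) := Y⁴ + x·Y − c·x²` (`c = 17`: the stratum-ρ1 exhibit `rho1` of node 27). -/
def quartC (c : ℤ) (j : ℕ) : ℤ[X] := if j = 0 then X ^ 4 else if j = 1 then X else if j = 2 then C (-c) else 0

/-- the x-coefficient vector of `R₂(c) := (Y² − c·x)² − x·Y = Y⁴ − 2c·x·Y² − x·Y + c²·x²` (`c = 17`: the stratum-ρ2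
exhibit `rho2` of node 27). -/
def bisqC (c : ℤ) (j : ℕ) : ℤ[X] :=
  if j = 0 then X ^ 4 else if j = 1 then C (-(2 * c)) * X ^ 2 - X else if j = 2 then C (c ^ 2) else 0

/-- the tree's `rho1` (`…RootDecomp1KSectorTheorem.rho1`, node 27 part 09) IS `quartC 17`. -/
theorem rho1_eq_quartC : rho1 = quartC 17 := by
  funext j; simp [rho1, quartC]

/-- the tree's `rho2` (`…RootDecomp1KSectorTheorem.rho2`, node 27 part 09) IS `bisqC 17`. -/
theorem rho2_eq_bisqC : rho2 = bisqC 17 := by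
  funext j; simp only [rho2, bisqC]; norm_num

/-- `(c : ℤ) : quartC c 0 = X ^ 4`. -/
theorem quartC_zero (c : ℤ) : quartC c 0 = X ^ 4 := by simp [quartC]
/-- `(c : ℤ) : quartC c 1 = X`. -/
theorem quartC_one (c : ℤ) : quartC c 1 = X := by simp [quartC]
/-- `(c : ℤ) : quartC c 2 = C (-c)`. -/
theorem quartC_two (c : ℤ) : quartC c 2 = C (-c) := by simp [quartC]
/-- `(c : ℤ) : bisqC c 0 = X ^ 4`. -/
theorem bisqC_zero (c : ℤ) : bisqC c 0 = X ^ 4 := by simp [bisqC]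
/-- `(c : ℤ) : bisqC c 1 = C (-(2 * c)) * X ^ 2 - X`. -/
theorem bisqC_one (c : ℤ) : bisqC c 1 = C (-(2 * c)) * X ^ 2 - X := by simp [bisqC]
/-- `(c : ℤ) : bisqC c 2 = C (c ^ 2)`. -/
theorem bisqC_two (c : ℤ) : bisqC c 2 = C (c ^ 2) := by simp [bisqC]

/-- `R₁(c)(x, y) = y⁴ + x·y − c·x²`. -/
@[simp] theorem bev_quartC (c : ℤ) (x y : ℝ) :
    bev (xPolyP 2 (quartC c)) x y = y ^ 4 + x * y - c * x ^ 2 := by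
  rw [bev_xPolyP]
  simp [Finset.sum_range_succ, quartC_zero, quartC_one, quartC_two]
  ring

/-- `R₂(c)(x, y) = y⁴ − 2c·x·y² − x·y + c²·x² = (y² − c·x)² − x·y`. -/
@[simp] theorem bev_bisqC (c : ℤ) (x y : ℝ) :
    bev (xPolyP 2 (bisqC c)) x y = y ^ 4 - 2 * c * x * y ^ 2 - x * y + c ^ 2 * x ^ 2 := by
  rw [bev_xPolyP]
  simp [Finset.sum_range_succ, bisqC_zero, bisqC_one, bisqC_two, map_ofNat]
  ring

/-! ## §1  ARITHMETIC OF THE DIGIT: `a` odd ⟹ `a⁸ ≡ 1 (mod 32)`; cubes and units mod 32 -/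

/-- `a` odd ⟹ `32 ∣ a⁸ − 1`. -/
theorem pow_eight_mod (a : ℤ) (ha : Odd a) : (32 : ℤ) ∣ a ^ 8 - 1 := by
  obtain ⟨k, rfl⟩ := ha
  have key : ∀ x : ZMod 32, (2 * x + 1) ^ 8 - 1 = 0 := by decide
  have h := key (k : ZMod 32)
  have : (((2 * k + 1) ^ 8 - 1 : ℤ) : ZMod 32) = 0 := by push_cast; exact h
  exact (ZMod.intCast_zmod_eq_zero_iff_dvd _ 32).mp this

/-- `32 ∣ c³ − 1 ⟹ 32 ∣ c − 1` (cubing is a bijection of the odd residues mod 32). -/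
theorem cube_mod (c : ℤ) (h : (32 : ℤ) ∣ c ^ 3 - 1) : (32 : ℤ) ∣ c - 1 := by
  have key : ∀ x : ZMod 32, x ^ 3 - 1 = 0 → x - 1 = 0 := by decide
  have h1 : ((c ^ 3 - 1 : ℤ) : ZMod 32) = 0 := (ZMod.intCast_zmod_eq_zero_iff_dvd _ 32).mpr h
  have h2 : ((c - 1 : ℤ) : ZMod 32) = 0 := by
    push_cast at h1 ⊢
    exact key _ h1
  exact (ZMod.intCast_zmod_eq_zero_iff_dvd _ 32).mp h2

/-- an odd integer is coprime to every power of two. -/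
theorem isCoprime_two_pow_of_odd {q : ℤ} (hq : Odd q) (m : ℕ) : IsCoprime q ((2 : ℤ) ^ m) := by
  rw [Int.isCoprime_iff_nat_coprime, Int.natAbs_pow]
  exact (Nat.coprime_two_right.mpr (Int.natAbs_odd.mpr hq)).pow_right m

/-- from `P·R = c²`, `P, R` coprime, `0 < P`: `P` is a square of a NON-ZERO integer when `c ≠ 0`. -/
theorem sq_of_coprime_pos {P R c : ℤ} (hcop : IsCoprime P R) (heq : P * R = c ^ 2) (hpos : 0 < P) :
    ∃ w : ℤ, P = w ^ 2 := by
  obtain ⟨w, hw | hw⟩ := Int.sq_of_isCoprime hcop heq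
  · exact ⟨w, hw⟩
  · exfalso; nlinarith [sq_nonneg w]

/-! ## §2  THE CORE OF ρ1: `W⁴ + p·2^m·W − c·p² = 0`, `p ≡ 1 (mod 2^m)`, `m ≥ 5`, `c` an odd prime `≢ 1 (mod 32)` ⟹ ⊥ -/

/-- **the descent + digit core for `R₁(c)`.** -/
theorem core_quart {c : ℤ} (hc : Prime c) (h32 : ¬ (32 : ℤ) ∣ c - 1) {m : ℕ} (hm : 5 ≤ m) {W p : ℤ}
    (hp0 : 0 < p) (hp1 : (2 : ℤ) ^ m ∣ p - 1) (h : W ^ 4 + p * 2 ^ m * W - c * p ^ 2 = 0) : False := by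
  -- p is odd
  have h32m : (32 : ℤ) ∣ 2 ^ m := by
    obtain ⟨t, ht⟩ : ∃ t, m = 5 + t := ⟨m - 5, by omega⟩
    exact ⟨2 ^ t, by rw [ht, pow_add]; norm_num⟩
  have hp_odd : Odd p := by
    have h2 : (2 : ℤ) ∣ p - 1 := (dvd_pow_self 2 (by omega)).trans hp1
    have : Even (p - 1) := even_iff_two_dvd.mpr h2
    have e : p = (p - 1) + 1 := by ring
    rw [e]; exact this.add_one
  have hW0 : W ≠ 0 := by
    rintro rfl
    have : c * p ^ 2 = 0 := by linear_combination -h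
    rcases mul_eq_zero.mp this with h0 | h0
    · exact hc.ne_zero h0
    · exact hp0.ne' (pow_eq_zero_iff (two_ne_zero) |>.mp h0)
  -- gcd split W = w·g, p = q·g
  obtain ⟨g, w, q, hg, hwq, hW, hp⟩ := Int.exists_gcd_one' (Int.gcd_pos_of_ne_zero_left p hW0)
  have hg0 : (g : ℤ) ≠ 0 := by exact_mod_cast hg.ne'
  have hq0 : 0 < q := by
    rcases lt_trichotomy q 0 with hq | hq | hq
    · exfalso; rw [hp] at hp0; nlinarith
    · exfalso; rw [hp, hq, zero_mul] at hp0; exact lt_irrefl _ hp0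
    · exact hq
  have hcop : IsCoprime w q := Int.isCoprime_iff_gcd_eq_one.mpr hwq
  -- the reduced equation (E): g²w⁴ + q·w·2^m − c·q² = 0
  have hE : (g : ℤ) ^ 2 * w ^ 4 + q * w * 2 ^ m - c * q ^ 2 = 0 := by
    have h' : (g : ℤ) ^ 2 * ((g : ℤ) ^ 2 * w ^ 4 + q * w * 2 ^ m - c * q ^ 2) = 0 := by
      rw [hW, hp] at h; linear_combination h
    rcases mul_eq_zero.mp h' with h0 | h0
    · exact absurd h0 (pow_ne_zero _ hg0)
    · exact h0
  -- q is odd (q ∣ p)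
  have hq_odd : Odd q := by
    refine Int.not_even_iff_odd.mp fun hqe => ?_
    have : Even p := by rw [hp]; exact hqe.mul_right _
    exact Int.not_even_iff_odd.mpr hp_odd this
  -- w ∣ c
  have hwc : w ∣ c := by
    have h1 : w ∣ c * q ^ 2 := ⟨(g : ℤ) ^ 2 * w ^ 3 + q * 2 ^ m, by linear_combination -hE⟩
    exact (hcop.pow_right (n := 2)).dvd_of_dvd_mul_right h1
  -- |w| = 1 or |w| = |c|
  have hc' : Nat.Prime c.natAbs := Int.prime_iff_natAbs_prime.mp hc
  rcases hc'.eq_one_or_self_of_dvd _ (Int.natAbs_dvd_natAbs.mpr hwc) with h1 | h1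
  · -- CASE |w| = 1: g² = q·(c·q − w·2^m), coprime factors ⟹ both squares
    have hw2 : w ^ 2 = 1 := by
      rcases Int.natAbs_eq_iff.mp h1 with rfl | rfl <;> norm_num
    have hw4 : w ^ 4 = 1 := by
      calc w ^ 4 = (w ^ 2) ^ 2 := by ring
        _ = 1 := by rw [hw2]; norm_num
    have hprod : q * (c * q - w * 2 ^ m) = (g : ℤ) ^ 2 := by
      rw [hw4] at hE; linear_combination -hE
    have hcop2 : IsCoprime q (c * q - w * 2 ^ m) := by
      have h0 : IsCoprime q (-(w * 2 ^ m)) :=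
        ((hcop.symm).mul_right (isCoprime_two_pow_of_odd hq_odd m)).neg_right
      have e : c * q - w * 2 ^ m = -(w * 2 ^ m) + q * c := by ring
      rw [e]; exact h0.add_mul_left_right c
    obtain ⟨a, ha⟩ := sq_of_coprime_pos hcop2 hprod hq0
    have hR0 : 0 < c * q - w * 2 ^ m := by
      have hg2 : 0 < (g : ℤ) ^ 2 := by positivity
      nlinarith
    obtain ⟨b, hb⟩ := sq_of_coprime_pos hcop2.symm (by rw [mul_comm]; exact hprod) hR0
    -- a is odd
    have ha_odd : Odd a := by
      refine Int.not_even_iff_odd.mp fun hae => ?_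
      have : Even q := by rw [ha]; exact (Int.even_pow' two_ne_zero).mpr hae
      exact Int.not_even_iff_odd.mpr hq_odd this
    -- 2^m ∣ c·a⁸ − 1 = a⁶·(c·a² − b²) + (p² − 1)
    have hp2 : p ^ 2 = a ^ 6 * b ^ 2 := by
      rw [hp, mul_pow, ← hprod, ← hb, ha]; ring
    have hdig : (2 : ℤ) ^ m ∣ c * a ^ 8 - 1 := by
      have h1 : (2 : ℤ) ^ m ∣ p ^ 2 - 1 := by
        have e : p ^ 2 - 1 = (p - 1) * (p + 1) := by ring
        rw [e]; exact dvd_mul_of_dvd_left hp1 _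
      have h2 : (2 : ℤ) ^ m ∣ c * a ^ 2 - b ^ 2 := ⟨w, by rw [← ha, ← hb]; ring⟩
      have e : c * a ^ 8 - 1 = a ^ 6 * (c * a ^ 2 - b ^ 2) + (p ^ 2 - 1) := by rw [hp2]; ring
      rw [e]; exact dvd_add (dvd_mul_of_dvd_right h2 _) h1
    have h3 : (32 : ℤ) ∣ c * a ^ 8 - 1 := h32m.trans hdig
    have h4 : (32 : ℤ) ∣ c - 1 := by
      have e : c - 1 = (c * a ^ 8 - 1) - c * (a ^ 8 - 1) := by ring
      rw [e]; exact dvd_sub h3 (dvd_mul_of_dvd_right (pow_eight_mod a ha_odd) _)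
    exact h32 h4
  · -- CASE |w| = |c|: w = c·v with v = ±1; q·(q − v·2^m) = c³·g²
    have hcw : c ∣ w := by
      have h0 : c ∣ (c.natAbs : ℤ) := Int.dvd_natAbs.mpr dvd_rfl
      rcases Int.natAbs_eq_iff.mp h1 with h2 | h2 <;> rw [h2]
      · exact h0
      · exact (dvd_neg).mpr h0
    have hwc2 : w ^ 2 = c ^ 2 := Int.natAbs_eq_iff_sq_eq.mp h1
    obtain ⟨v, hv⟩ := hcw
    subst hv
    have hcq : IsCoprime c q := hcop.of_isCoprime_of_dvd_left (dvd_mul_right c v)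
    have hv2 : v ^ 2 = 1 := by
      have h0 : c ^ 2 * (v ^ 2 - 1) = 0 := by linear_combination hwc2
      rcases mul_eq_zero.mp h0 with h0 | h0
      · exact absurd h0 (pow_ne_zero _ hc.ne_zero)
      · linear_combination h0
    have hv4 : v ^ 4 = 1 := by
      calc v ^ 4 = (v ^ 2) ^ 2 := by ring
        _ = 1 := by rw [hv2]; norm_num
    -- the reduced equation q·(q − v·2^m) = c³·g²
    have hE' : q * (q - v * 2 ^ m) = c ^ 3 * (g : ℤ) ^ 2 := by
      have h' : c * (c ^ 3 * (g : ℤ) ^ 2 + v * q * 2 ^ m - q ^ 2) = 0 := by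
        linear_combination hE - c ^ 4 * (g : ℤ) ^ 2 * hv4
      rcases mul_eq_zero.mp h' with h0 | h0
      · exact absurd h0 hc.ne_zero
      · linear_combination -h0
    -- c³ ∣ q − v·2^m (c ∤ q)
    have hc3 : c ^ 3 ∣ q - v * 2 ^ m :=
      (hcq.pow_left (m := 3)).dvd_of_dvd_mul_left ⟨(g : ℤ) ^ 2, by linear_combination hE'⟩
    obtain ⟨c', hc'⟩ := hc3
    have hprod : q * c' = (g : ℤ) ^ 2 := by
      have h0 : c ^ 3 * (q * c' - (g : ℤ) ^ 2) = 0 := by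
        have e : c ^ 3 * (q * c' - (g : ℤ) ^ 2) = q * (c ^ 3 * c') - c ^ 3 * (g : ℤ) ^ 2 := by ring
        rw [e, ← hc', hE']; ring
      rcases mul_eq_zero.mp h0 with h0 | h0
      · exact absurd h0 (pow_ne_zero _ hc.ne_zero)
      · linear_combination h0
    have hcop2 : IsCoprime q c' := by
      have hqv : IsCoprime q v := ⟨0, v, by linear_combination hv2⟩
      have h0 : IsCoprime q (-(v * 2 ^ m)) := (hqv.mul_right (isCoprime_two_pow_of_odd hq_odd m)).neg_right
      have h2 : IsCoprime q (q - v * 2 ^ m) := by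
        have e : q - v * 2 ^ m = -(v * 2 ^ m) + q * 1 := by ring
        rw [e]; exact h0.add_mul_left_right 1
      exact h2.of_isCoprime_of_dvd_right ⟨c ^ 3, by rw [hc']; ring⟩
    obtain ⟨a, ha⟩ := sq_of_coprime_pos hcop2 hprod hq0
    have hR0 : 0 < c' := by
      have hg2 : 0 < (g : ℤ) ^ 2 := by positivity
      nlinarith
    obtain ⟨b, hb⟩ := sq_of_coprime_pos hcop2.symm (by rw [mul_comm]; exact hprod) hR0
    have ha_odd : Odd a := by
      refine Int.not_even_iff_odd.mp fun hae => ?_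
      have : Even q := by rw [ha]; exact (Int.even_pow' two_ne_zero).mpr hae
      exact Int.not_even_iff_odd.mpr hq_odd this
    have hp2 : p ^ 2 = a ^ 6 * b ^ 2 := by
      rw [hp, mul_pow, ← hprod, ← hb, ha]; ring
    -- 2^m ∣ a⁸ − c³ = a⁶·(a² − c³·b²) + c³·(p² − 1)
    have hdig : (2 : ℤ) ^ m ∣ a ^ 8 - c ^ 3 := by
      have h1 : (2 : ℤ) ^ m ∣ p ^ 2 - 1 := by
        have e : p ^ 2 - 1 = (p - 1) * (p + 1) := by ring
        rw [e]; exact dvd_mul_of_dvd_left hp1 _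
      have h2 : (2 : ℤ) ^ m ∣ a ^ 2 - c ^ 3 * b ^ 2 := ⟨v, by rw [← ha, ← hb, ← hc']; ring⟩
      have e : a ^ 8 - c ^ 3 = a ^ 6 * (a ^ 2 - c ^ 3 * b ^ 2) + c ^ 3 * (p ^ 2 - 1) := by rw [hp2]; ring
      rw [e]; exact dvd_add (dvd_mul_of_dvd_right h2 _) (dvd_mul_of_dvd_right h1 _)
    have h3 : (32 : ℤ) ∣ a ^ 8 - c ^ 3 := h32m.trans hdig
    have h4 : (32 : ℤ) ∣ c ^ 3 - 1 := by
      have e : c ^ 3 - 1 = (a ^ 8 - 1) - (a ^ 8 - c ^ 3) := by ring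
      rw [e]; exact dvd_sub (pow_eight_mod a ha_odd) h3
    exact h32 (cube_mod c h4)

/-- `17` is prime in `ℤ` and `17 ≢ 1 (mod 32)`. -/
theorem prime_seventeen : Prime (17 : ℤ) := Int.prime_iff_natAbs_prime.mpr (by norm_num)

/-- `: ¬ (32 : ℤ) ∣ 17 - 1`. -/
theorem not_dvd_sixteen : ¬ (32 : ℤ) ∣ 17 - 1 := by decide

/-! ## §3  CLEARING THE LEVEL EQUATION of `Y⁴ + α·x·Y² + β·x·Y + γ·x²` at a dyadic abscissa `x = p/2^{2m}` -/

/-- (P1) the INTEGER level equation: `a⁴·2^{4m} + α·p·a²·d²·2^{2m} + β·p·a·d³·2^{2m} + γ·p²·d⁴ = 0` (`r = a/d`). -/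
theorem int_eq4 (α β γ p : ℤ) (m : ℕ) (r : ℚ)
    (h : (r : ℝ) ^ 4 + (α : ℝ) * ((p : ℝ) / 2 ^ (2 * m)) * (r : ℝ) ^ 2 + (β : ℝ) * ((p : ℝ) / 2 ^ (2 * m)) * r
        + (γ : ℝ) * ((p : ℝ) / 2 ^ (2 * m)) ^ 2 = 0) :
    r.num ^ 4 * 2 ^ (4 * m) + α * p * r.num ^ 2 * (r.den : ℤ) ^ 2 * 2 ^ (2 * m)
      + β * p * r.num * (r.den : ℤ) ^ 3 * 2 ^ (2 * m) + γ * p ^ 2 * (r.den : ℤ) ^ 4 = 0 := by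
  have hnum : ((r.num : ℚ) : ℝ) = (r : ℝ) * (r.den : ℝ) := by
    have e : ((r * r.den : ℚ) : ℝ) = ((r.num : ℚ) : ℝ) := by rw [Rat.mul_den_eq_num]
    push_cast at e ⊢
    exact e.symm
  push_cast at hnum
  have hd : (0 : ℝ) < r.den := by exact_mod_cast r.den_pos
  have h2 : (2 : ℝ) ^ (2 * m) ≠ 0 := pow_ne_zero _ two_ne_zero
  have key : ((r.num ^ 4 * 2 ^ (4 * m) + α * p * r.num ^ 2 * (r.den : ℤ) ^ 2 * 2 ^ (2 * m)
      + β * p * r.num * (r.den : ℤ) ^ 3 * 2 ^ (2 * m) + γ * p ^ 2 * (r.den : ℤ) ^ 4 : ℤ) : ℝ) =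
      (r.den : ℝ) ^ 4 * ((2 : ℝ) ^ (2 * m)) ^ 2 * ((r : ℝ) ^ 4 + (α : ℝ) * ((p : ℝ) / 2 ^ (2 * m)) * (r : ℝ) ^ 2
        + (β : ℝ) * ((p : ℝ) / 2 ^ (2 * m)) * r + (γ : ℝ) * ((p : ℝ) / 2 ^ (2 * m)) ^ 2) := by
    push_cast
    rw [hnum, show (4 * m) = 2 * (2 * m) by ring, pow_mul']
    field_simp
  rw [h, mul_zero] at key
  exact_mod_cast key

end Summit.Schanuel.Schanuel.Theorems.RootDecomp1KResidueDescent
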